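import Summits.QuantumFields.BalabanUV.T4Continuum.Support.NE7GradientCurrencyLandauEL
import Summits.QuantumFields.BalabanUV.T4Continuum.Support.NE7LatticeLandauEuler
import HarnessLib

/-!
# NE7 support (162): the gradient currency in the EXACT lattice Landau gauge — the reaction letter `r` is `0`

Sub-problem `BalabanUV/T4Continuum`, row NE7 of `CLAIMS.md` (the averaging property (APE) at the trivial flat datum), chain
«the gradient currency `a₁` of REP♭ is not an independent letter» ((156) `NE7LatticeHodgeGradient`, (157) `NE7GradientCurrency`,
(158) `NE7GradientCurrencyCovariant`, (158b) `NE7GradientCurrencyLandauEL`, (161a) `NE7LatticeLandauMinimiser`,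
(161b) `NE7LatticeLandauEuler`).

(158b) `gradient_currency_of_covDiv_EL` bounds every forward difference of a bond field `A₀` with `U^{u₀} = e^{A₀}` by
`4·(d·a₀∕R + R·(j + d·ε·((e^{2a₀} − 1) + 2ε(2 + ε)) + r))`, where `a₀ = sup ‖A₀‖`, `ε` is the small-field letter of `U`, `j` bounds the
covariant flux divergence `covDiv 1 U`, and `r` bounds the forward differences of the LANDAU REACTION in Euler–Lagrange form
`Σ_μ [sinh A₀(x)_μ − sinh A₀(x − e_μ)_μ]`.  (161b) `exists_latticeLandauGauge` produces, for every `P`-periodic `U`, a unitary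
`P`-periodic gauge `u` with `u 0 = 1` minimising the trace link functional, whose gauged field `W = U^{u}` satisfies the lattice Landau
condition `Σ_κ [(W(z)_κ − W(z)_κᴴ) − (W(z − e_κ)_κ − W(z − e_κ)_κᴴ)] = 0` at every site.  For a skew-Hermitian `A₀` with `W = e^{A₀}` one
has `W − Wᴴ = e^{A₀} − e^{−A₀} = 2 sinh A₀`, so the Landau condition is exactly the vanishing of the reaction: `r = 0`.

MAIN RESULT `gradient_currency_latticeLandau`: for `d ≥ 1`, `P ≥ 1`, a `P`-periodic `U` with small field `ε ≥ 0` and `‖covDiv 1 U‖ ≤ j`,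
THERE IS a unitary `P`-periodic gauge `u`, `u 0 = 1`, minimising the trace link functional, such that EVERY skew-Hermitian `P`-periodic
`A₀` with `U^{u} = e^{A₀}`, `‖A₀‖ ≤ a₀ ≤ 1∕64` and `144·d·R·a₀ ≤ 1` obeys
`‖A₀(y + e_τ)_κ − A₀(y)_κ‖ ≤ 4·(d·a₀∕R + R·(j + d·ε·((e^{2a₀} − 1) + 2ε(2 + ε))))` — the gradient currency from `(a₀, j)` ALONE.

HONEST ACCOUNTING: a composition BY NAME of (158b) and (161b) plus `(e^{A})ᴴ = e^{Aᴴ}` (`Matrix.exp_conjTranspose`); the sup letter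
`a₀` and the flux-divergence letter `j` stay HYPOTHESES (the existence of such an `A₀`, i.e. the sup letter of the minimiser, is NOT
proved here); nothing of Bałaban's is asserted; (APE) is NOT proved; NE7 is NOT PRINTED ∕ NOT PROVED; spine 0∕9; not infinite volume,
not mass gap, not Clay.  No `sorry`.  PLACEMENT: our lemma, under `Summits/QuantumFields/BalabanUV/`.
-/

set_option autoImplicit false

open NormedSpace
open scoped BigOperators Matrix Matrix.Norms.L2Operator
open Finset

namespace Summit.QuantumFields.BalabanUV.T4Continuum.NE7GradientCurrencyLatticeLandau

open Literature.MathematicalPhysics.QuantumFieldTheory.Balaban1983to89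
open B7Prop1Explicit B7Prop2Explicit MatrixNorms UnitaryModel
open B8Ineq132 (covDiv)
open T4AveragingDeficitWall (vary SmallField)
open T4AveragingDeficitWallBoundary (IsPeriodicCfg periodBox mem_periodBox)
open AveragingDeficitPeriodicCounting (IsPeriodicDir)
open BlockAveragePushDirSplit (flat)
open NE7GradientCurrency (vary_flat_one_apply)
open NE7GradientCurrencyLandauEL (gradient_currency_of_covDiv_EL)
open NE7LatticeLandauEuler (exists_latticeLandauGauge)

noncomputable section

variable {d : ℕ} {n : Type*} [Fintype n] [DecidableEq n] [Nonempty n]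

omit [Nonempty n] in
/-- **THE LANDAU CONDITION IS THE VANISHING OF THE `sinh`-REACTION.**  If `W(z)_κ = e^{A(z)_κ}` with `A` skew-Hermitian and
`Σ_κ [(W(z)_κ − W(z)_κᴴ) − (W(z − e_κ)_κ − W(z − e_κ)_κᴴ)] = 0`, then `Σ_κ [sinh A(z)_κ − sinh A(z − e_κ)_κ] = 0`
(`sinh X = (e^X − e^{−X})∕2`, `(e^X)ᴴ = e^{Xᴴ} = e^{−X}`). [folklore] -/
theorem sum_sinh_sub_eq_zero_of_landau (A : Site d → Fin d → Matrix n n ℂ) (hskew : ∀ (y : Site d) (κ : Fin d), (A y κ)ᴴ = -A y κ)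
    (z : Site d)
    (h : ∑ κ : Fin d, ((exp (A z κ) - (exp (A z κ))ᴴ) - (exp (A (z - e κ) κ) - (exp (A (z - e κ) κ))ᴴ)) = 0) :
    ∑ κ : Fin d, (((2 : ℂ)⁻¹ • (exp (A z κ) - exp (-A z κ))) - ((2 : ℂ)⁻¹ • (exp (A (z - e κ) κ) - exp (-A (z - e κ) κ)))) = 0 := by
  have hH : ∀ (y : Site d) (κ : Fin d), (exp (A y κ))ᴴ = exp (-A y κ) := fun y κ => by
    rw [← Matrix.exp_conjTranspose, hskew]
  simp only [hH] at h
  simp_rw [← smul_sub]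
  rw [← Finset.smul_sum, h, smul_zero]

/-- **IN THE EXACT LATTICE LANDAU GAUGE THE FLAT DIVERGENCE OF `A` IS QUADRATICALLY SMALL.**  If `‖A‖ ≤ a₀` and the `sinh`-reaction
vanishes at `z`, `Σ_κ [sinh A(z)_κ − sinh A(z − e_κ)_κ] = 0`, then `‖Σ_κ [A(z)_κ − A(z − e_κ)_κ]‖ ≤ 2d·(e^{a₀} − 1)·a₀`
(`sinh − id` is `(e^{a₀} − 1)`-Lipschitz, (158b) `norm_sinhRem_sub_sinhRem_le` at `Y = 0`): the divergence letter of the N3 div–curl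
bootstrap costs `O(a₀²)`, not `O(a₀)`. [folklore] -/
theorem norm_flatDiv_le_of_sinhReaction_eq_zero (A : Site d → Fin d → Matrix n n ℂ) {a₀ : ℝ}
    (hA : ∀ (y : Site d) (κ : Fin d), ‖A y κ‖ ≤ a₀) (z : Site d)
    (h : ∑ κ : Fin d, (((2 : ℂ)⁻¹ • (exp (A z κ) - exp (-A z κ))) - ((2 : ℂ)⁻¹ • (exp (A (z - e κ) κ) - exp (-A (z - e κ) κ)))) = 0) :
    ‖∑ κ : Fin d, (A z κ - A (z - e κ) κ)‖ ≤ 2 * d * ((Real.exp a₀ - 1) * a₀) := by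
  have hrem : ∀ (y : Site d) (κ : Fin d), ‖((2 : ℂ)⁻¹ • (exp (A y κ) - exp (-A y κ)) - A y κ)‖ ≤ (Real.exp a₀ - 1) * a₀ := by
    intro y κ
    have ha₀ : 0 ≤ a₀ := (norm_nonneg _).trans (hA y κ)
    have h0 : ‖(0 : Matrix n n ℂ)‖ ≤ a₀ := by rw [norm_zero]; exact ha₀
    have h1 := NE7GradientCurrencyLandauEL.norm_sinhRem_sub_sinhRem_le (X := A y κ) (Y := (0 : Matrix n n ℂ)) (ρ := a₀) (hA y κ) h0
    simp only [neg_zero, NormedSpace.exp_zero, sub_self, smul_zero, sub_zero] at h1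
    exact h1.trans (mul_le_mul_of_nonneg_left (hA y κ) (by linarith [Real.add_one_le_exp a₀]))
  have hid : ∑ κ : Fin d, (A z κ - A (z - e κ) κ)
      = ∑ κ : Fin d, ((A z κ - ((2 : ℂ)⁻¹ • (exp (A z κ) - exp (-A z κ))))
          - (A (z - e κ) κ - ((2 : ℂ)⁻¹ • (exp (A (z - e κ) κ) - exp (-A (z - e κ) κ)))))
        + ∑ κ : Fin d, (((2 : ℂ)⁻¹ • (exp (A z κ) - exp (-A z κ))) - ((2 : ℂ)⁻¹ • (exp (A (z - e κ) κ) - exp (-A (z - e κ) κ)))) := by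
    rw [← Finset.sum_add_distrib]
    exact Finset.sum_congr rfl fun κ _ => by abel
  rw [hid, h, add_zero]
  calc ‖∑ κ : Fin d, ((A z κ - ((2 : ℂ)⁻¹ • (exp (A z κ) - exp (-A z κ))))
          - (A (z - e κ) κ - ((2 : ℂ)⁻¹ • (exp (A (z - e κ) κ) - exp (-A (z - e κ) κ)))))‖
      ≤ ∑ κ : Fin d, ((Real.exp a₀ - 1) * a₀ + (Real.exp a₀ - 1) * a₀) := by
        refine norm_sum_le_of_le _ fun κ _ => (norm_sub_le _ _).trans (add_le_add ?_ ?_)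
        · rw [norm_sub_rev]; exact hrem z κ
        · rw [norm_sub_rev]; exact hrem (z - e κ) κ
    _ = 2 * d * ((Real.exp a₀ - 1) * a₀) := by
        rw [Finset.sum_const, Finset.card_univ, Fintype.card_fin, nsmul_eq_mul]; ring

/-- **(162) THE GRADIENT CURRENCY IN THE EXACT LATTICE LANDAU GAUGE, FROM `(a₀, j)` ALONE.**  For `d ≥ 1`, `P ≥ 1` and a `P`-periodic
bond field `U` with small field `ε ≥ 0` and covariant flux divergence `‖covDiv 1 U ν x‖ ≤ j`: there is a unitary, `P`-periodic gauge `u`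
with `u 0 = 1` MINIMISING the trace link functional `Σ_{x ∈ periodBox P} Σ_κ (1 − Re tr U^{u}(x)_κ ∕ n)` over that class ((161a)), whose
gauged field satisfies the lattice Landau condition ((161b)), and consequently, for every skew-Hermitian `A₀` with `U^{u} = e^{A₀}`
and `‖A₀‖ ≤ a₀`: (i) the flat divergence is quadratically small, `‖Σ_κ [A₀(z)_κ − A₀(z − e_κ)_κ]‖ ≤ 2d(e^{a₀} − 1)a₀` at every site;
(ii) if moreover `A₀` is `P`-periodic, `a₀ ≤ 1∕64`, and `R ≥ 1` with `144·d·R·a₀ ≤ 1`, then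
`‖A₀(y + e_τ)_κ − A₀(y)_κ‖ ≤ 4·(d·a₀∕R + R·(j + d·ε·((e^{2a₀} − 1) + 2ε(2 + ε))))` ((158b) with `r = 0`). [folklore] -/
theorem gradient_currency_latticeLandau (hd : 1 ≤ d) {P : ℕ} (hP : 1 ≤ P) {U : Site d → Fin d → (Matrix n n ℂ)ˣ}
    (hUP : IsPeriodicCfg U (P : ℤ)) {ε j : ℝ} (hε0 : 0 ≤ ε) (hUε : SmallField U ε)
    (hcov : ∀ (ν : Fin d) (x : Site d), ‖covDiv 1 U ν x‖ ≤ j) :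
    ∃ u : Site d → (Matrix n n ℂ)ˣ, (∀ x, u x ∈ unitaryUnits (Matrix n n ℂ)) ∧ (∀ (x : Site d) (τ : Fin d), u (x + (P : ℤ) • e τ) = u x) ∧
      u 0 = 1 ∧
      (∀ v : Site d → (Matrix n n ℂ)ˣ, (∀ x, v x ∈ unitaryUnits (Matrix n n ℂ)) → (∀ (x : Site d) (τ : Fin d), v (x + (P : ℤ) • e τ) = v x) →
        v 0 = 1 →
        ∑ x ∈ periodBox (d := d) P, ∑ κ : Fin d, (1 - nReTr ((gaugeAct u U x κ : (Matrix n n ℂ)ˣ) : Matrix n n ℂ))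
          ≤ ∑ x ∈ periodBox (d := d) P, ∑ κ : Fin d, (1 - nReTr ((gaugeAct v U x κ : (Matrix n n ℂ)ˣ) : Matrix n n ℂ))) ∧
      ∀ (A₀ : Site d → Fin d → Matrix n n ℂ), gaugeAct u U = vary (flat (d := d) (n := n)) A₀ 1 →
        (∀ (y : Site d) (κ : Fin d), (A₀ y κ)ᴴ = -A₀ y κ) →
        ∀ (a₀ : ℝ), (∀ (y : Site d) (κ : Fin d), ‖A₀ y κ‖ ≤ a₀) →
        (∀ z : Site d, ‖∑ κ : Fin d, (A₀ z κ - A₀ (z - e κ) κ)‖ ≤ 2 * d * ((Real.exp a₀ - 1) * a₀)) ∧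
        (IsPeriodicDir A₀ (P : ℤ) → a₀ ≤ 1 / 64 → ∀ (R : ℕ), 1 ≤ R → 144 * (d : ℝ) * R * a₀ ≤ 1 →
          ∀ (y : Site d) (κ τ : Fin d),
            ‖A₀ (y + e τ) κ - A₀ y κ‖ ≤ 4 * ((d : ℝ) * a₀ / R + R * (j + d * (ε * ((Real.exp (2 * a₀) - 1) + 2 * ε * (2 + ε)))))) := by
  obtain ⟨u, hu, huP, hu0, hmin, hEL⟩ := exists_latticeLandauGauge (d := d) (n := n) hP hUP
  refine ⟨u, hu, huP, hu0, hmin, ?_⟩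
  intro A₀ hgauge hskew a₀ ha₀
  have hW : ∀ (z : Site d) (μ : Fin d), ((gaugeAct u U z μ : (Matrix n n ℂ)ˣ) : Matrix n n ℂ) = exp (A₀ z μ) := fun z μ => by
    rw [hgauge, vary_flat_one_apply, val_expUnit]
  have key : ∀ z : Site d,
      ∑ μ : Fin d, (((2 : ℂ)⁻¹ • (exp (A₀ z μ) - exp (-A₀ z μ))) - ((2 : ℂ)⁻¹ • (exp (A₀ (z - e μ) μ) - exp (-A₀ (z - e μ) μ)))) = 0 :=
    fun z => sum_sinh_sub_eq_zero_of_landau A₀ hskew z (by simpa only [hW] using hEL z)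
  have hEL' : ∀ (x : Site d) (ν : Fin d),
      ‖∑ μ, (((2 : ℂ)⁻¹ • (exp (A₀ (x + e ν) μ) - exp (-A₀ (x + e ν) μ)))
                - ((2 : ℂ)⁻¹ • (exp (A₀ (x + e ν - e μ) μ) - exp (-A₀ (x + e ν - e μ) μ))))
          - ∑ μ, (((2 : ℂ)⁻¹ • (exp (A₀ x μ) - exp (-A₀ x μ))) - ((2 : ℂ)⁻¹ • (exp (A₀ (x - e μ) μ) - exp (-A₀ (x - e μ) μ))))‖
        ≤ 0 := fun x ν => by
    rw [key (x + e ν), key x, sub_self, norm_zero]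
  refine ⟨fun z => norm_flatDiv_le_of_sinhReaction_eq_zero A₀ ha₀ z (key z), fun hA₀P ha₀s R hR hreg y κ τ => ?_⟩
  have h := gradient_currency_of_covDiv_EL hd hε0 hUε hcov hu hgauge hP hA₀P ha₀ ha₀s hEL' hR hreg y κ τ
  simpa only [add_zero] using h

end

end Summit.QuantumFields.BalabanUV.T4Continuum.NE7GradientCurrencyLatticeLandau
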